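import Literature.Claims.NS.ClayVariants
import Literature.Analysis.FluidPDE.RadialCalculus
import Literature.Analysis.FunctionSpaces.JapaneseBracketDerivatives
import HarnessLib

/-!
# Claim skeleton (D-0090 NS-CLAIMS, C114): Kovacevic 2016 — «Example of no solution at ℝ³ and t = 0»
# for an explicit divergence-free field and an explicit force

Typed skeleton of Dejan Kovacevic, *Incompressible Navier–Stokes Equations: Example of no solution at ℝ³
and t = 0*, arXiv:1608.04975 [physics.flu-dyn] **v1** (16 Aug 2016; the only version; 28 pp.; PDF page =
printed page) = bib `Kovacevic2016`, the text of record of cell `ns-claims` row C114 (QUICK; sources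
`run/shared/lean/pub/ns-claims/sources/Kovacevic2016/`, LOCATORS.md by ns-claims-lit-1 g4). UNREFEREED
CLAIM under adjudication — NOTHING in this file asserts a step of the paper: the paper's statements are
`def … : Prop`; the only `theorem`s are the kernel composition of the paper's OWN implication
(`claim_of_steps`) and the Clay-delta theorem `clay_of_claimed_of_delta` (cell TYPING-HYGIENE 10(b)).
Verdict vocabulary is the refuter's / referee's.

## The claimed statement, as printed (Theorem 1.1, p.3)
«Let u⃗(x⃗) = (u_i(x⃗))_{1≤i≤3} ∈ ℝ³ be divergence-free ∇·u⃗ = 0 velocity vector field for incompressible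
fluid ρ = const occupying all of ℝ³ space, where p(x⃗,t) ∈ ℝ represents fluid pressure and f⃗(x⃗,t)
represents the vector field related to the external force applied on fluid, for any position x⃗ ∈ ℝ³ in
space at t ≥ 0. Than the Navier-Stokes equation for incompressible fluid ∂u⃗/∂t + (u⃗·∇)u⃗ = −∇p/ρ + νΔu⃗
+ f⃗ does not have solution for all positions in space x⃗ ∈ ℝ³ at t = 0, for vector fields u⃗(x⃗) and
f⃗(x⃗,t) defined as: u_i(x⃗) = 2(x_{h(i−1)} − x_{h(i+1)})/(1 + Σⱼ xⱼ²)², i = 1,2,3 [h(l) = l for 1 ≤ l ≤ 3,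
h(4) = 1, h(0) = 3], and f⃗(x⃗,t) = (0, 0, 1/(1 + t²(Σⱼ xⱼ)²)).» The Introduction (p.1) fixes what
«solution» means: «it is not known if a smooth, divergence-free vector field u⃗₀(x⃗) and smooth f⃗(x⃗,t)
exist, for which there exist no solutions for pressure p(x⃗,t) and GIVEN velocity vector field u⃗ at any
position in space x⃗ ∈ ℝ³ at t = 0»; p.2: «the fluid velocity vector field u⃗₀(x⃗) = u⃗(x⃗) … for which we
prove that the Navier-Stokes equation … does not have a solution at any position in space x⃗ ∈ ℝ³ at
t = 0»; and the proof's (1.196) p.24: «∂u⃗/∂t = 0⃗ for any x⃗ ∈ ℝ³, t ≥ 0» — the velocity is the PRESCRIBED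
time-independent field, the only unknown is the pressure.

TYPED (`ClaimedTheorem`): for every `ν > 0`, `ρ > 0` there is NO differentiable `p : ℝ³ → ℝ` such that the
momentum equation holds on `ℝ³` at `t = 0` for the frozen velocity `(t, x) ↦ u(x)` (so `∂ₜu = 0`, Step 2),
the printed `u` (`uField = 2(a × x)/(1+|x|²)²`, `a = (1,1,1)`) and the printed `f` (`force`, `f(·,0) ≡
(0,0,1)`): `∂ₜu + (u·∇)u = νΔu − ∇p/ρ + f(·,0)` has no solution `p`. («for all positions … at t = 0» is
read as «on ℝ³ at t = 0»; a pointwise-in-x reading has no content for an unknown function `p`.)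

## Delta to Clay (`ClayVariants` §3): the typed statement is NOT Clay (C) — `ClayDelta`
(C) = `clayR3.Breakdown`: for every `ν > 0` there are a datum `u₀` of class (4) and a force `f` of class
(5) such that NO smooth `(u, p)` on `ℝ³ × [0,∞)` solves (1)(2)(3) with `u(·,0) = u₀` and bounded energy.
`ClaimedTheorem` speaks of a pressure for a FROZEN velocity; it implies (C) exactly under the bridging
hypothesis `ClayDelta` = (Δ4) the printed datum is of class (4) [it is not: `|u(x)| ~ 2|a × x̂|/|x|³`,
algebraic decay] ∧ (Δ3) the printed force is of class (5) [it is not: `f(x,0) ≡ (0,0,1)` does not decay]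
∧ (Δ6 FORM OF THE CONCLUSION / Δ2) «every Clay-sense solution of the Cauchy problem with datum `u` and
force `f` has `∂ₜu(·,0) ≡ 0`» (= (1.196) read about the Cauchy problem; for a genuine solution the
equation at `t = 0` determines `∂ₜu(0) = ℙ(νΔu₀ − (u₀·∇)u₀ + f(·,0))`, which vanishes only for steady
data). `clay_of_claimed_of_delta : FieldProperties → ClayDelta → ClaimedTheorem → clayR3.Breakdown` is
PROVED; `clay_of_claimed` is not derivable. Δ1 `ℝ³` = · Δ7 `ν` unquantified in print (typed ∀ `ν > 0`;
the frozen-field statement also makes sense at `ν = 0`).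

## Ordered Step index (print order; `claim_of_steps` takes them in this order)
* Step 1 = `FieldProperties` — p.2 «Analysis of u⃗(x⃗)» / «Analysis of f⃗(x⃗,t)» bullets, proved as
  (1.3)–(1.194) pp.3–23: `u` smooth, divergence-free, energy `∫|u|² = π²` (1.3x), `u(0) = 0`, `u → 0` at
  `∞`, all derivatives bounded; `f ∈ C^∞`.
* Step 2 = `Eq196` — (1.196) p.24 «∂u⃗/∂t = 0⃗ for any x⃗ ∈ ℝ³, t ≥ 0» (the prescribed velocity does not
  depend on `t`).
* Step 3 = `Eq198_200` — (1.197)–(1.200) p.24: `((u·∇)u)_i = 4(Σⱼxⱼ − 3xᵢ)/(1+|x|²)⁴` (the paper calls it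
  «diffusion term») and `νΔu_i = 8ν dᵢ (|x|² + 1 − 6)/(1+|x|²)⁴`.
* Step 4 = `NoPressure` — (1.201)–(1.206) pp.24–26: `g⃗ := ∇p/ρ = νΔu + f − ∂ₜu − (u·∇)u` (1.202)–(1.203);
  the three componentwise antiderivatives (1.204) «∫g₁dx₁», (1.205), (1.206) «represent the solution for
  pressure … All three results are mutually different» ⇒ no pressure: typed as its content «(1.202) has no
  differentiable solution `p` at `t = 0`» (i.e. `g(·,0)` is not `ρ⁻¹∇p`). LOAD-BEARING. PROVED
  (`noPressure_holds`, last section: `Dg(0)` is not symmetric).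
* Step 5 = `Indeterminate208` — (1.207)–(1.208) p.26: the term `ArcTan(t(x₁+x₂+x₃))/t` of (1.206) «at the
  point in time t = 0 … results with ArcTan(0)/0 = 0/0 which cannot be determined for any x⃗ ∈ ℝ³ at
  t = 0» — typed as printed about the function `t ↦ arctan(t s)/t`: no limiting value at `t = 0` (the
  paper's second ground for «no solution»; the composition does not need it).
COMPOSITION: proved as `claim_of_steps : FieldProperties → Eq196 → Eq198_200 → NoPressure →
Indeterminate208 → ClaimedTheorem` (consumes Steps 2 and 4; p.26 «Based on the three mutually different
resulting equations for pressure … one of which … cannot be determined … we can conclude …»).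

## References
* D. Kovacevic, arXiv:1608.04975v1 (`Kovacevic2016`): abstract p.1, Introduction pp.1–3 (approach bullets
  p.2–3), Theorem 1.1 p.3, (1.1)–(1.2) p.3, (1.3)–(1.194) pp.3–23, (1.195)–(1.203) p.24, (1.204)–(1.206)
  pp.25–26, (1.207)–(1.208) + concluding sentence p.26, §2 Discussion pp.26–28.
* Cell files: `claims/Kovacevic2016/CARD.md` (typist-1 g2, PREDICTION 2026-08-27T00:48:28Z),
  `sources/Kovacevic2016/LOCATORS.md` (lit-1 g4; force reading corrected 23:27Z on the render p003).

WHAT THIS IS NOT: not a claim about NS regularity or blow-up; not a claim about any author beyond the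
typed locator.
-/

noncomputable section

open Set Filter Topology MeasureTheory
open scoped ContDiff ENNReal
open Laplacian

namespace Literature.Claims.NS.Kovacevic2016

open Literature.Analysis.FluidPDE

/-! ## The printed fields -/

/-- Physical space `ℝ³`. [folklore] -/
abbrev E3 : Type := EuclideanSpace ℝ (Fin 3)

/-- (1.1) p.3: `dᵢ = x_{h(i−1)} − x_{h(i+1)}`, i.e. `d = (x₃ − x₂, x₁ − x₃, x₂ − x₁) = a × x` with
`a = (1,1,1)` (0-based coordinates `x 0, x 1, x 2`). [cite: Kovacevic2016, (1.1) p.3] -/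
def dVec (x : E3) : E3 :=
  !₂[x 2 - x 1, x 0 - x 2, x 1 - x 0]

/-- (1.2) p.3: `S = 1 + Σⱼ xⱼ² = 1 + |x|²`. [cite: Kovacevic2016, (1.2) p.3] -/
def sFun (x : E3) : ℝ :=
  1 + ‖x‖ ^ 2

/-- The printed velocity field of Theorem 1.1 p.3: `uᵢ(x) = 2 dᵢ/(1+|x|²)²`, i.e.
`u = 2(a × x)/(1+|x|²)²`. [cite: Kovacevic2016, Theorem 1.1 p.3] -/
def uField (x : E3) : E3 :=
  (2 / sFun x ^ 2) • dVec x

/-- The printed force of Theorem 1.1 p.3 (render p003): `f(x,t) = (0, 0, 1/(1 + t²(x₁+x₂+x₃)²))` — smooth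
and bounded on `ℝ³ × [0,∞)`, `f(·,0) ≡ (0,0,1)`. [cite: Kovacevic2016, Theorem 1.1 p.3] -/
def force (t : ℝ) (x : E3) : E3 :=
  EuclideanSpace.single (2 : Fin 3) (1 / (1 + t ^ 2 * (x 0 + x 1 + x 2) ^ 2))

/-- The velocity the proof inserts into the equation «for any x⃗ ∈ ℝ³, t ≥ 0» ((1.195)–(1.196) p.24): the
time-INDEPENDENT field `(t, x) ↦ u(x)`. [cite: Kovacevic2016, (1.196) p.24; Introduction p.1 «given velocity vector field»] -/
def frozen : ℝ → E3 → E3 :=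
  fun _ x => uField x

/-! ## The claimed theorem -/

/-- **CLAIMED THEOREM** (Theorem 1.1 p.3, in the reading fixed by the Introduction p.1 and by (1.196)
p.24): for the prescribed time-independent velocity `u` and the force `f`, the momentum equation
`∂ₜu + (u·∇)u = νΔu − ∇p/ρ + f` has NO (differentiable) pressure solution `p` on `ℝ³` at `t = 0`.
[claim: Kovacevic2016, status: under-review] [cite: Kovacevic2016, Theorem 1.1 p.3; Introduction p.1–2; (1.196), (1.202) p.24; p.26 concluding sentence] -/
def ClaimedTheorem : Prop :=
  ∀ ν ρ : ℝ, 0 < ν → 0 < ρ →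
    ¬ ∃ p : E3 → ℝ, Differentiable ℝ p ∧
        ∀ x : E3,
          derivWithin (fun s => frozen s x) (Ici 0) 0 + fderiv ℝ uField x (uField x) =
            ν • (Δ uField) x - ρ⁻¹ • gradient p x + force 0 x

/-! ## The Steps of the printed argument -/

/-- **Step 1 — properties of the fields** (p.2 bullets «Analysis of u⃗(x⃗) vector field» / «Analysis of
f⃗(x⃗,t) vector field», carried out as (1.3)–(1.194) pp.3–23): `u ∈ C^∞` is divergence-free ((1.14)),
has energy `∫_{ℝ³}|u|² dx = π²`, vanishes at the origin and tends to `0` at infinity, every derivative is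
bounded on `ℝ³`; `f ∈ C^∞` (typed: smooth on the closed half-space `ℝ³ × [0,∞)`).
[claim: Kovacevic2016, status: under-review] [cite: Kovacevic2016, p.2 bullets; (1.3)–(1.194) pp.3–23] -/
def FieldProperties : Prop :=
  ContDiff ℝ ∞ uField ∧ NSWave0.IsDivFree uField ∧
    (∫⁻ x, ‖uField x‖ₑ ^ 2) = ENNReal.ofReal (Real.pi ^ 2) ∧
    uField 0 = 0 ∧ Tendsto uField (cocompact E3) (𝓝 0) ∧
    (∀ n : ℕ, ∃ C : ℝ, ∀ x : E3, ‖iteratedFDeriv ℝ n uField x‖ ≤ C) ∧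
    IsSmoothOnHalfSpace force

/-- **Step 2 — (1.196) p.24**: «Once the fluid velocity vector field u⃗ and force field f⃗, as defined in
the theorem statement, are applied in the Navier-Stokes equation (1.195), the terms … can be expressed
in following way: ∂u⃗/∂t = 0⃗ (1.196) for any x⃗ ∈ ℝ³, t ≥ 0» — the prescribed velocity has zero time
derivative (one-sided at `t = 0`). [claim: Kovacevic2016, status: under-review] [cite: Kovacevic2016, (1.196) p.24] -/
def Eq196 : Prop :=
  ∀ (t : ℝ) (x : E3), 0 ≤ t → derivWithin (fun s => frozen s x) (Ici 0) t = 0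

/-- **Step 3 — (1.197)–(1.200) p.24**: the convective term («diffusion term» in the paper's words)
`((u·∇)u)ᵢ = cᵢ = 4(Σⱼxⱼ − 3xᵢ)/(1+Σⱼxⱼ²)⁴` and the viscous term `νΔuᵢ = lᵢ = 8ν dᵢ(Σⱼxⱼ² + 1 − 6)/
(Σⱼxⱼ² + 1)⁴`, for every `x`. [claim: Kovacevic2016, status: under-review] [cite: Kovacevic2016, (1.197)–(1.200) p.24] -/
def Eq198_200 : Prop :=
  ∀ ν : ℝ, ∀ x : E3,
    fderiv ℝ uField x (uField x) =
        (4 / sFun x ^ 4) • ((x 0 + x 1 + x 2) • !₂[(1 : ℝ), 1, 1] - (3 : ℝ) • x) ∧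
      ν • (Δ uField) x = (8 * ν * (sFun x - 6) / sFun x ^ 4) • dVec x

/-- **Step 4 — (1.201)–(1.206) pp.24–26, LOAD-BEARING**: with `g⃗ := ∇p/ρ = νΔu⃗ + f⃗ − ∂u⃗/∂t −
(u⃗·∇)u⃗` ((1.201)–(1.203)), the three componentwise antiderivatives (1.204) `p = ∫ g₁ dx₁ + C(y,z) + C`,
(1.205) `∫ g₂ dx₂ + C(x,z) + C`, (1.206) `∫ g₃ dx₃ + C(x,y) + C` «represent the solution for presure
p(x⃗,t). All three results are mutually different» ⇒ no pressure exists. Typed as the content used by the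
conclusion: at `t = 0` (where `∂u⃗/∂t = 0⃗` by (1.196)) the field `νΔu + f(·,0) − (u·∇)u` is not `ρ⁻¹∇p`
for any differentiable `p` on `ℝ³`. [claim: Kovacevic2016, status: under-review] [cite: Kovacevic2016, (1.201)–(1.203) p.24; (1.204)–(1.206) pp.25–26 «All three results are mutually different»] -/
def NoPressure : Prop :=
  ∀ ν ρ : ℝ, 0 < ν → 0 < ρ →
    ¬ ∃ p : E3 → ℝ, Differentiable ℝ p ∧
        ∀ x : E3, ρ⁻¹ • gradient p x = ν • (Δ uField) x + force 0 x - fderiv ℝ uField x (uField x)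

/-- **Step 5 — (1.207)–(1.208) p.26**: the first term `ArcTan(t(x₁+x₂+x₃))/t` of (1.206) «at the point in
time t = 0 … results with ArcTan(0)/0 = 0/0 (1.208) which cannot be determined for any x⃗ ∈ ℝ³ at t = 0»,
typed as printed about the function `t ↦ arctan(t·s)/t`, `s = x₁+x₂+x₃`: it has no limiting value at
`t = 0`. (The paper's second ground for the conclusion; not consumed by the composition.)
[claim: Kovacevic2016, status: under-review] [cite: Kovacevic2016, (1.207)–(1.208) p.26] -/
def Indeterminate208 : Prop :=
  ∀ s : ℝ, ¬ ∃ L : ℝ, Tendsto (fun t : ℝ => Real.arctan (t * s) / t) (𝓝[≠] 0) (𝓝 L)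

/-! ## Kernel composition -/

/-- **COMPOSITION** (p.26: «Based on the three mutually different resulting equations for pressure
(1.204), (1.205) and (1.206) … we can conclude that the Navier-Stokes equation …, for the velocity vector
field u⃗(x⃗) and the external force related vector field f⃗(x⃗,t) …, does not have solution at any
position in space x⃗ ∈ ℝ³ at t = 0»): a pressure solving the momentum equation for the frozen field at
`t = 0` would, by (1.196), solve (1.202) — excluded by Step 4. Steps 1, 3, 5 enter as unused binders.
[cite: Kovacevic2016, proof of Theorem 1.1, concluding paragraph p.26] -/
theorem claim_of_steps (_h₁ : FieldProperties) (h₂ : Eq196) (_h₃ : Eq198_200) (h₄ : NoPressure)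
    (_h₅ : Indeterminate208) : ClaimedTheorem := by
  intro ν ρ hν hρ ⟨p, hp, heq⟩
  refine h₄ ν ρ hν hρ ⟨p, hp, fun x => ?_⟩
  have hx := heq x
  rw [h₂ 0 x le_rfl, zero_add] at hx
  rw [hx]
  abel

/-! ## The Clay delta (cell TYPING-HYGIENE 10(b)): what would make the claim a Clay (C) statement -/

/-- **`ClayDelta` — the exact bridging hypothesis from `ClaimedTheorem` to Clay (C)** (`ClayVariants`
§3 axes): (Δ4 DATA) the printed datum is of class (4) `HasRapidSpatialDecay`; (Δ3 FORCE) the printed force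
is of class (5) `HasRapidSpaceTimeDecay`; (Δ6 FORM OF THE CONCLUSION / Δ2) every Clay-sense solution
`(u′, p′)` of the Cauchy problem (1)(2)(3) with viscosity `ν`, force `f` and datum `u` has `∂ₜu′(·,0) ≡ 0`
— (1.196) read as a statement about the Cauchy problem, i.e. «the solution is the frozen datum to first
order at t = 0». None of the three is printed as a theorem; each is what the identification «Theorem 1.1 =
an instance of (C)» would need. [claim: Kovacevic2016, status: under-review] [cite: Kovacevic2016, Theorem 1.1 p.3; (1.196) p.24; §2 p.26 «there exists u⃗(x⃗) and f⃗(x⃗,t) smooth vector fields, such that the Navier-Stokes equation … does not have solution»] -/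
def ClayDelta : Prop :=
  HasRapidSpatialDecay uField ∧ HasRapidSpaceTimeDecay force ∧
    ∀ ν : ℝ, 0 < ν →
      ∀ (u' : ℝ → E3 → E3) (p' : ℝ → E3 → ℝ),
        IsSmoothOnHalfSpace u' → IsSmoothOnHalfSpace p' → IsNavierStokesSolution ν force uField u' p' →
          HasBoundedEnergy u' → ∀ x : E3, derivWithin (fun s => u' s x) (Ici 0) 0 = 0

/-- The time-zero slice of a field smooth on the closed half-space is differentiable (private helper).
[folklore] -/
private theorem differentiable_slice_zero {p' : ℝ → E3 → ℝ} (hp : IsSmoothOnHalfSpace p') :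
    Differentiable ℝ (p' 0) := by
  have hs : IsSmoothSpaceTimeOn (Ici (0 : ℝ)) p' := hp
  exact (hs.contDiff_slice (t := 0) (by simp)).differentiable (by simp)

/-- **`FieldProperties → ClayDelta → ClaimedTheorem → clayR3.Breakdown`** (Clay (C) in the cell's
reference schema, with the paper's witnesses `u`, `f`): under the bridging hypothesis a Clay-sense solution
from the datum `u` would have `∂ₜu′(0) = 0` and `u′(0) = u`, so its pressure at `t = 0` would solve the
frozen momentum equation — excluded by `ClaimedTheorem`. Without `ClayDelta` this implication is not
derivable (module docstring). [claim: Kovacevic2016, status: under-review] [cite: Kovacevic2016, Theorem 1.1 p.3; §2 p.26] -/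
theorem clay_of_claimed_of_delta (h₁ : FieldProperties) (hΔ : ClayDelta) (hC : ClaimedTheorem) :
    ClayVariants.clayR3.Breakdown := by
  intro ν hν
  obtain ⟨hsmooth, hdiv, -, -, -, -, hforce⟩ := h₁
  obtain ⟨hdec, hfcl, hfrozen⟩ := hΔ
  refine ClayVariants.ClaySpec.BreakdownAt.of_not_solvable (S := ClayVariants.clayR3)
    hsmooth hdiv hdec hforce hfcl ?_
  rintro ⟨u', p', hu, hp, hns, hE⟩
  refine hC ν 1 hν one_pos ⟨p' 0, differentiable_slice_zero hp, fun x => ?_⟩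
  have h0 : derivWithin (fun s => u' s x) (Ici 0) 0 = 0 := hfrozen ν hν u' p' hu hp hns hE x
  have hmom := hns.momentum 0 le_rfl x
  rw [h0, hns.initial] at hmom
  have hfz : derivWithin (fun s => frozen s x) (Ici 0) 0 = 0 := by
    simp [frozen]
  rw [hfz, inv_one, one_smul]
  exact hmom

/-- The same, landing on the tree's (C) leaf `NavierStokesBreakdownR3` via `ClayVariants.clayR3_breakdown_iff`.
[claim: Kovacevic2016, status: under-review] [cite: Kovacevic2016, Theorem 1.1 p.3] -/
theorem clayC_of_claimed_of_delta (h₁ : FieldProperties) (hΔ : ClayDelta) (hC : ClaimedTheorem) :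
    Summit.NavierStokesRegularity.NavierStokesRegularity.NavierStokesBreakdownR3 :=
  ClayVariants.clayR3_breakdown_iff.mp (clay_of_claimed_of_delta h₁ hΔ hC)

/-! ## (1.197)–(1.200) in the kernel — Step 3 is TRUE
Appended 2026-08-27 by the CARD custodian (ns-claims-typist-1 g4, D-0026 debt pass); nothing above is
modified, no statement changes; the adjudicated locator (`ClaimedTheorem`, STATEMENT / wrong problem, #51)
is untouched. Tools: the tree's radial calculus `Literature.Analysis.FluidPDE.fderiv_comp_norm_sq_apply` /
`laplacian_comp_norm_sq` (one new import, `Literature.Analysis.FluidPDE.RadialCalculus`, Mathlib-only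
dependencies) and the second-derivative trace `laplacian_eq_sum_fderiv_fderiv`. With `eq196_holds`
(Theorems-side, `…Theorems.Kovacevic2016.eq196_holds`) Steps 2 and 3 are now both kernel-true; the
remaining hypothesis of `…Theorems.Kovacevic2016.claim_of_noPressure` besides Step 4 is `FieldProperties`.
Step 4 itself is proved below (`noPressure_holds`, section «Step 4 in the kernel», appended 2026-08-27),
and with Step 2 ((1.196), `derivWithin_const`) so is the claimed statement in its own frozen-field reading
(`claimedTheorem_holds`); the row's located failure — the identification with Clay (C),
`ClayDelta` — is refuted Theorems-side and is untouched. -/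

open scoped RealInnerProductSpace


/-- The radial profile of the printed field: `u = g(|x|²) · d` with `g(σ) = 2/(1+σ)²`. [cite: Kovacevic2016, Theorem 1.1 p.3] -/
private def gK (σ : ℝ) : ℝ := 2 / (1 + σ) ^ 2

/-- `g′(σ) = −4/(1+σ)³`. [folklore] -/
private def gK₁ (σ : ℝ) : ℝ := -4 / (1 + σ) ^ 3

/-- `g″(σ) = 12/(1+σ)⁴`. [folklore] -/
private def gK₂ (σ : ℝ) : ℝ := 12 / (1 + σ) ^ 4

/-- `g′ = g₁` on `σ > −1`. [folklore] -/
private theorem hasDerivAt_gK {σ : ℝ} (hσ : -1 < σ) : HasDerivAt gK (gK₁ σ) σ := by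
  have hne : (1 + σ) ≠ 0 := by linarith
  have h : HasDerivAt (fun s : ℝ => (1 + s) ^ 2) (2 * (1 + σ)) σ := by
    have := ((hasDerivAt_id σ).const_add 1).pow 2
    refine this.congr_deriv ?_
    simp
  have h2 : HasDerivAt (fun s : ℝ => 2 / (1 + s) ^ 2) (-(2 * (2 * (1 + σ))) / ((1 + σ) ^ 2) ^ 2) σ :=
    (hasDerivAt_const σ (2 : ℝ)).div h (pow_ne_zero 2 hne) |>.congr_deriv (by ring)
  refine (h2.congr_of_eventuallyEq (Eventually.of_forall fun s => rfl)).congr_deriv ?_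
  unfold gK₁
  field_simp
  ring

/-- `g₁′ = g₂` on `σ > −1`. [folklore] -/
private theorem hasDerivAt_gK₁ {σ : ℝ} (hσ : -1 < σ) : HasDerivAt gK₁ (gK₂ σ) σ := by
  have hne : (1 + σ) ≠ 0 := by linarith
  have h : HasDerivAt (fun s : ℝ => (1 + s) ^ 3) (3 * (1 + σ) ^ 2) σ := by
    have := ((hasDerivAt_id σ).const_add 1).pow 3
    refine this.congr_deriv ?_
    simp
  have h2 : HasDerivAt (fun s : ℝ => -4 / (1 + s) ^ 3) (-(-4 * (3 * (1 + σ) ^ 2)) / ((1 + σ) ^ 3) ^ 2) σ :=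
    (hasDerivAt_const σ (-4 : ℝ)).div h (pow_ne_zero 3 hne) |>.congr_deriv (by ring)
  refine (h2.congr_of_eventuallyEq (Eventually.of_forall fun s => rfl)).congr_deriv ?_
  unfold gK₂
  field_simp
  ring

/-- `|x|² > −1`. [folklore] -/
private theorem norm_sq_gt (x : E3) : ‖x‖ ^ 2 ∈ Ioi (-1 : ℝ) := by
  have : (0 : ℝ) ≤ ‖x‖ ^ 2 := sq_nonneg _
  show (-1 : ℝ) < ‖x‖ ^ 2
  linarith

/-- The scalar factor `x ↦ g(|x|²) = 2/(1+|x|²)²` is `C²`. [folklore] -/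
private theorem contDiff_phi : ContDiff ℝ 2 (fun w : E3 => gK (‖w‖ ^ 2)) := by
  show ContDiff ℝ 2 (fun w : E3 => 2 / (1 + ‖w‖ ^ 2) ^ 2)
  refine contDiff_const.div ((contDiff_const.add (contDiff_norm_sq ℝ)).pow 2) fun w => ?_
  positivity

/-- `D(g(|·|²))(x) v = 2 g₁(|x|²) ⟨x, v⟩`. [folklore] -/
private theorem fderiv_phi (x v : E3) :
    fderiv ℝ (fun w : E3 => gK (‖w‖ ^ 2)) x v = 2 * gK₁ (‖x‖ ^ 2) * ⟪x, v⟫ :=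
  fderiv_comp_norm_sq_apply (hasDerivAt_gK (norm_sq_gt x)) v

/-- `Δ(g(|·|²))(x) = 4 g₂(|x|²)|x|² + 6 g₁(|x|²)` (`dim = 3`). [folklore] -/
private theorem laplacian_phi (x : E3) :
    (Δ (fun w : E3 => gK (‖w‖ ^ 2))) x = 4 * gK₂ (‖x‖ ^ 2) * ‖x‖ ^ 2 + 6 * gK₁ (‖x‖ ^ 2) := by
  rw [laplacian_comp_norm_sq isOpen_Ioi (fun σ hσ => hasDerivAt_gK hσ) (norm_sq_gt x)
    (hasDerivAt_gK₁ (norm_sq_gt x)), finrank_euclideanSpace_fin]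
  push_cast
  ring

/-! ### The linear factor `d(x) = (1,1,1) × x` -/

/-- `d` as a linear map. [cite: Kovacevic2016, (1.1) p.3] -/
private def dLin : E3 →ₗ[ℝ] E3 where
  toFun := dVec
  map_add' x y := by
    ext i; fin_cases i <;> simp [dVec] <;> ring
  map_smul' c x := by
    ext i; fin_cases i <;> simp [dVec] <;> ring

/-- `d` as a continuous linear map. [cite: Kovacevic2016, (1.1) p.3] -/
private def dL : E3 →L[ℝ] E3 := LinearMap.toContinuousLinearMap dLin

/-- `dL` is `d`. [folklore] -/
private theorem dL_apply (x : E3) : dL x = dVec x := rfl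

/-- `x ⊥ d(x)`. [folklore] -/
private theorem inner_self_dVec (x : E3) : ⟪x, dVec x⟫ = 0 := by
  simp [dVec, PiLp.inner_apply, Fin.sum_univ_three]
  ring

/-- `d(d(x)) = a × (a × x) = (Σx) a − 3x`. [cite: Kovacevic2016, (1.197)–(1.198) p.24] -/
private theorem dVec_dVec (x : E3) :
    dVec (dVec x) = (x 0 + x 1 + x 2) • !₂[(1 : ℝ), 1, 1] - (3 : ℝ) • x := by
  ext i; fin_cases i <;> simp [dVec] <;> ring

/-- `u = g(|x|²) · d(x)`. [cite: Kovacevic2016, Theorem 1.1 p.3] -/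
private theorem uField_eq : uField = fun w => gK (‖w‖ ^ 2) • dL w := by
  funext w
  rfl

/-- `S = 1 + |x|² ≠ 0`. [folklore] -/
private theorem sFun_ne_zero (x : E3) : sFun x ≠ 0 := by
  have : (0 : ℝ) ≤ ‖x‖ ^ 2 := sq_nonneg _
  unfold sFun
  linarith

/-! ### Leibniz rule for `Δ(φ · L)` with `L` linear -/

/-- **`Δ(φ L)(x) = (Δφ)(x) L x + 2 Σᵢ (∂ᵢφ)(x) L bᵢ`** for `φ ∈ C²` and a continuous linear `L`
(`ΔL = 0`, `∂ᵢL = L bᵢ`). [folklore] -/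
private theorem laplacian_smul_clm {φ : E3 → ℝ} (hφ : ContDiff ℝ 2 φ) (L : E3 →L[ℝ] E3) (x : E3) :
    (Δ (fun y => φ y • L y)) x =
      (Δ φ) x • L x + (2 : ℝ) • ∑ i, (fderiv ℝ φ x (stdOrthonormalBasis ℝ E3 i)) •
        L (stdOrthonormalBasis ℝ E3 i) := by
  set b := stdOrthonormalBasis ℝ E3
  have hφ1 : ContDiff ℝ 1 φ := hφ.of_le one_le_two
  have hφd : ∀ y, DifferentiableAt ℝ φ y := fun y => hφ1.differentiable one_ne_zero y
  have hψ : ∀ c, ContDiff ℝ 1 fun y => fderiv ℝ φ y c := fun c =>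
    (hφ.fderiv_right (m := 1) le_rfl).clm_apply contDiff_const
  have hψd : ∀ c y, DifferentiableAt ℝ (fun y => fderiv ℝ φ y c) y := fun c y =>
    (hψ c).differentiable one_ne_zero y
  have hu : ContDiff ℝ 2 (fun y => φ y • L y) := hφ.smul L.contDiff
  rw [laplacian_eq_sum_fderiv_fderiv b hu x, laplacian_eq_sum_fderiv_fderiv b hφ x,
    Finset.sum_smul, Finset.smul_sum, ← Finset.sum_add_distrib]
  refine Finset.sum_congr rfl fun i _ => ?_
  -- the first derivative of `φ L`, as a function of the base point
  have h1 : (fun y => fderiv ℝ (fun y => φ y • L y) y (b i)) =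
      fun y => φ y • L (b i) + (fderiv ℝ φ y (b i)) • L y := by
    funext y
    rw [fderiv_fun_smul (hφd y) L.differentiableAt, L.fderiv, _root_.add_apply,
      _root_.smul_apply, ContinuousLinearMap.smulRight_apply]
  rw [h1]
  have hA : DifferentiableAt ℝ (fun y => φ y • L (b i)) x := (hφd x).smul_const _
  have hB : DifferentiableAt ℝ (fun y => (fderiv ℝ φ y (b i)) • L y) x :=
    (hψd (b i) x).smul L.differentiableAt
  rw [fderiv_fun_add hA hB, _root_.add_apply, fderiv_smul_const (hφd x),
    ContinuousLinearMap.smulRight_apply, fderiv_fun_smul (hψd (b i) x) L.differentiableAt, L.fderiv,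
    _root_.add_apply, _root_.smul_apply,
    ContinuousLinearMap.smulRight_apply, two_smul]
  abel

/-! ### Step 3 in the kernel -/

/-- **Step 3 HOLDS (kernel)** — (1.197)–(1.200) p.24: for `u = 2d/S²`, `d = (1,1,1) × x`,
`S = 1 + |x|²`, the convective term is `(u·∇)u = (4/S⁴)((Σⱼxⱼ)(1,1,1) − 3x)` (the radial factor is
not differentiated since `x ⊥ d(x)`, and `d(d(x)) = (Σⱼxⱼ)(1,1,1) − 3x`) and the viscous term is
`νΔu = 8ν(S − 6) d/S⁴` (`Δ(g(|x|²) d) = (Δg(|x|²) + 4g′(|x|²)) d` with `g(σ) = 2/(1+σ)²`: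
`48|x|²/S⁴ − 24/S³ − 16/S³ = (8S − 48)/S⁴`). Net Literature debt −1; no statement of this file is
changed; the adjudicated locator (`ClaimedTheorem`, wrong problem, #51) is untouched.
[cite: Kovacevic2016, (1.197)–(1.200) p.24] -/
theorem eq198_200_holds : Eq198_200 := by
  intro ν x
  have hS : sFun x = 1 + ‖x‖ ^ 2 := rfl
  have hS0 := sFun_ne_zero x
  refine ⟨?_, ?_⟩
  · -- the convective term
    have hφd : DifferentiableAt ℝ (fun w : E3 => gK (‖w‖ ^ 2)) x :=
      (contDiff_phi.differentiable (by norm_num) x)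
    rw [uField_eq, fderiv_fun_smul hφd dL.differentiableAt, dL.fderiv, _root_.add_apply,
      _root_.smul_apply, ContinuousLinearMap.smulRight_apply, fderiv_phi, map_smul]
    simp only [dL_apply, inner_smul_right, inner_self_dVec, mul_zero, zero_smul, add_zero, dVec_dVec,
      smul_smul]
    congr 1
    rw [gK, ← hS]
    field_simp
    ring
  · -- the viscous term
    rw [uField_eq, laplacian_smul_clm contDiff_phi dL x, laplacian_phi]
    simp_rw [fderiv_phi, dL_apply]
    have hsum : ∑ i, (2 * gK₁ (‖x‖ ^ 2) * ⟪x, stdOrthonormalBasis ℝ E3 i⟫) •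
        dVec (stdOrthonormalBasis ℝ E3 i) = (2 * gK₁ (‖x‖ ^ 2)) • dVec x := by
      have hrepr : ∑ i, ⟪x, stdOrthonormalBasis ℝ E3 i⟫ • stdOrthonormalBasis ℝ E3 i = x := by
        conv_rhs => rw [← (stdOrthonormalBasis ℝ E3).sum_repr' x]
        refine Finset.sum_congr rfl fun i _ => ?_
        rw [real_inner_comm]
      calc ∑ i, (2 * gK₁ (‖x‖ ^ 2) * ⟪x, stdOrthonormalBasis ℝ E3 i⟫) • dVec (stdOrthonormalBasis ℝ E3 i)
          = (2 * gK₁ (‖x‖ ^ 2)) • dL (∑ i, ⟪x, stdOrthonormalBasis ℝ E3 i⟫ • stdOrthonormalBasis ℝ E3 i) := by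
            rw [map_sum, Finset.smul_sum]
            refine Finset.sum_congr rfl fun i _ => ?_
            rw [map_smul, dL_apply, smul_smul]
        _ = (2 * gK₁ (‖x‖ ^ 2)) • dVec x := by rw [hrepr, dL_apply]
    rw [hsum, smul_smul, ← add_smul, smul_smul]
    congr 1
    rw [gK₁, gK₂, ← hS]
    have h1 : ‖x‖ ^ 2 = sFun x - 1 := by rw [hS]; ring
    rw [h1]
    field_simp
    ring


/-! ### Step 4 in the kernel -/

/-- The second linear factor of (1.197)–(1.198), `W(x) = (Σⱼxⱼ)(1,1,1) − 3x`, as a linear map.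
[cite: Kovacevic2016, (1.197)–(1.198) p.24] -/
private def wLin : E3 →ₗ[ℝ] E3 where
  toFun x := (x 0 + x 1 + x 2) • !₂[(1 : ℝ), 1, 1] - (3 : ℝ) • x
  map_add' x y := by
    ext i; fin_cases i <;> simp <;> ring
  map_smul' c x := by
    ext i; fin_cases i <;> simp <;> ring

/-- `W` as a continuous linear map. [cite: Kovacevic2016, (1.197)–(1.198) p.24] -/
private def wL : E3 →L[ℝ] E3 := LinearMap.toContinuousLinearMap wLin

/-- `wL` is `W`. [folklore] -/
private theorem wL_apply (x : E3) : wL x = (x 0 + x 1 + x 2) • !₂[(1 : ℝ), 1, 1] - (3 : ℝ) • x := rfl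

/-- `S(0) = 1`. [folklore] -/
private theorem sFun_zero : sFun 0 = 1 := by simp [sFun]

/-- `S = 1 + |x|²` is smooth. [folklore] -/
private theorem contDiff_sFun : ContDiff ℝ ∞ sFun := by
  show ContDiff ℝ ∞ (fun w : E3 => 1 + ‖w‖ ^ 2)
  exact contDiff_const.add (contDiff_norm_sq ℝ)

/-- The field `g := νΔu + f(·,0) − (u·∇)u` of (1.202)–(1.203) in closed form, by Step 3:
`g = (8ν(S−6)/S⁴) d + e₃ − (4/S⁴) W`. [cite: Kovacevic2016, (1.197)–(1.203) p.24] -/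
private theorem gField_eq (ν : ℝ) (x : E3) :
    ν • (Δ uField) x + force 0 x - fderiv ℝ uField x (uField x) =
      (8 * ν * (sFun x - 6) / sFun x ^ 4) • dL x + EuclideanSpace.single 2 1 -
        (4 / sFun x ^ 4) • wL x := by
  obtain ⟨h1, h2⟩ := eq198_200_holds ν x
  rw [h1, h2, dL_apply, wL_apply]
  simp [force]

/-- The closed-form field is differentiable, with derivative at the origin
`Dg(0) v = −40ν d(v) − 4 W(v)` (both `d` and `W` vanish at `0`, `S(0) = 1`). [folklore] -/
private theorem hasFDerivAt_gField_zero (ν : ℝ) :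
    ∃ G : E3 →L[ℝ] E3,
      HasFDerivAt (fun x : E3 => (8 * ν * (sFun x - 6) / sFun x ^ 4) • dL x +
          EuclideanSpace.single 2 1 - (4 / sFun x ^ 4) • wL x) G 0 ∧
        ∀ v, G v = (-(40 * ν)) • dVec v - (4 : ℝ) • wL v := by
  have hψ₁ : ContDiff ℝ ∞ (fun x : E3 => 8 * ν * (sFun x - 6) / sFun x ^ 4) :=
    (contDiff_const.mul (contDiff_sFun.sub contDiff_const)).div (contDiff_sFun.pow 4)
      fun x => pow_ne_zero 4 (sFun_ne_zero x)
  have hψ₂ : ContDiff ℝ ∞ (fun x : E3 => 4 / sFun x ^ 4) :=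
    contDiff_const.div (contDiff_sFun.pow 4) fun x => pow_ne_zero 4 (sFun_ne_zero x)
  have hd₁ := (hψ₁.differentiable (by simp) 0).hasFDerivAt
  have hd₂ := (hψ₂.differentiable (by simp) 0).hasFDerivAt
  have hA := hd₁.smul dL.hasFDerivAt
  have hB := hd₂.smul wL.hasFDerivAt
  have hC := (hA.add (hasFDerivAt_const (EuclideanSpace.single (2 : Fin 3) (1 : ℝ)) 0)).sub hB
  refine ⟨_, hC, fun v => ?_⟩
  rw [map_zero dL, map_zero wL]
  simp [sFun_zero, dL_apply]
  module

/-- A differentiable `p` with `∇p = ρ g` for a differentiable field `g` has the symmetric second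
derivative `ρ⟪Dg(x) v, w⟫ = ρ⟪Dg(x) w, v⟫` (Schwarz; Mathlib `second_derivative_symmetric`). [folklore] -/
private theorem inner_fderiv_symm_of_gradient {p : E3 → ℝ} {g : E3 → E3} {ρ : ℝ}
    (hp : Differentiable ℝ p) (hpg : ∀ x, gradient p x = ρ • g x) {x : E3} {G : E3 →L[ℝ] E3}
    (hg : HasFDerivAt g G x) (v w : E3) : ρ * ⟪G v, w⟫ = ρ * ⟪G w, v⟫ := by
  -- `Dp(y) = ρ ⟪g(y), ·⟫`
  have hf : ∀ y, HasFDerivAt p (ρ • innerSL ℝ (g y)) y := by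
    intro y
    have h := (hp y).hasGradientAt
    rw [hasGradientAt_iff_hasFDerivAt, hpg y] at h
    refine h.congr_fderiv ?_
    ext z
    simp [innerSL_apply_apply]
  have hx : HasFDerivAt (fun y => ρ • innerSL ℝ (g y))
      (ρ • (innerSL ℝ : E3 →L[ℝ] E3 →L[ℝ] ℝ).comp G) x :=
    ((innerSL ℝ : E3 →L[ℝ] E3 →L[ℝ] ℝ).hasFDerivAt.comp x hg).const_smul ρ
  have key := second_derivative_symmetric hf hx v w
  simpa [innerSL_apply_apply] using key

/-- **Step 4 HOLDS (kernel)** — (1.201)–(1.206) pp.24–26: the field `g = νΔu⃗ + f⃗(·,0) − (u⃗·∇)u⃗`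
of (1.202)–(1.203) is not `ρ⁻¹∇p` for any differentiable `p` on `ℝ³` («All three results are mutually
different»): a differentiable `p` with `∇p = ρ g` would be twice differentiable with symmetric second
derivative (`g` is smooth), whereas by the closed forms of Step 3 (`eq198_200_holds`)
`Dg(0) v = −40ν (a × v) − 4((a·v) a − 3v)`, `a = (1,1,1)`, whose part `−40ν (a × ·)` is antisymmetric:
`⟪Dg(0) e₁, e₂⟫ − ⟪Dg(0) e₂, e₁⟫ = −80ν ≠ 0`. Net Literature debt −1; no statement of this file is
changed; the adjudicated locator (`ClaimedTheorem`, wrong problem, #51) is untouched — with Steps 2–4 now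
kernel-true, `claim_of_steps` leaves `FieldProperties` as the only undischarged hypothesis of the paper's
own (frozen-field) conclusion. [cite: Kovacevic2016, (1.201)–(1.206) pp.24–26] -/
theorem noPressure_holds : NoPressure := by
  intro ν ρ hν hρ ⟨p, hp, hpg⟩
  obtain ⟨G, hG, hGv⟩ := hasFDerivAt_gField_zero ν
  have hpg' : ∀ x, gradient p x = ρ • ((8 * ν * (sFun x - 6) / sFun x ^ 4) • dL x +
      EuclideanSpace.single 2 1 - (4 / sFun x ^ 4) • wL x) := by
    intro x
    rw [← gField_eq ν x, ← hpg x, smul_smul, mul_inv_cancel₀ hρ.ne', one_smul]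
  have hsym := inner_fderiv_symm_of_gradient hp hpg' hG
    (EuclideanSpace.single 0 1) (EuclideanSpace.single 1 1)
  rw [hGv, hGv, wL_apply, wL_apply] at hsym
  simp [dVec, PiLp.inner_apply] at hsym
  rcases hsym with h | h
  · linarith
  · exact hρ.ne' h


/-- **THE CLAIMED THEOREM HOLDS in its own, frozen-field reading** (Theorem 1.1 p.3 read with the
Introduction p.1 and (1.196) p.24, exactly as typed in `ClaimedTheorem`): for the prescribed
time-independent `u` and the force `f`, the momentum equation has no differentiable pressure on `ℝ³` at
`t = 0` — by Step 4 (`noPressure_holds`) and Step 2 ((1.196): the frozen field has zero one-sided time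
derivative, Mathlib `derivWithin_const`; Theorems-side `…Theorems.Kovacevic2016.eq196_holds`), along the
paper's own composition (`claim_of_steps` consumes exactly these two Steps). This certifies the adjudicated reading of row #51 («the
printed Theorem 1.1 in its own frozen-field reading expected TRUE»): the located failure is the
identification with Clay (C), i.e. the bridge `ClayDelta`, refuted Theorems-side
(`…Theorems.Kovacevic2016.not_ClayDelta`); a true statement about a prescribed field is not breakdown of
a solution evolving from a datum. [cite: Kovacevic2016, Theorem 1.1 p.3; (1.196), (1.201)–(1.203) p.24; p.26 concluding sentence] -/
theorem claimedTheorem_holds : ClaimedTheorem := by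
  intro ν ρ hν hρ ⟨p, hp, heq⟩
  refine noPressure_holds ν ρ hν hρ ⟨p, hp, fun x => ?_⟩
  have h0 : derivWithin (fun s => frozen s x) (Ici 0) 0 = 0 :=
    congrFun (derivWithin_const (Ici (0 : ℝ)) (uField x)) 0
  have hx := heq x
  rw [h0, zero_add] at hx
  rw [hx]
  abel

/-! ## Step 1 (`FieldProperties`) in the kernel (D-0026 debt pass, ns-claims-lit-3 g7, 2026-08-27)

The printed field is `u(x) = ⟨x⟩^{-4} · 2 d(x)` with `⟨x⟩ = (1+|x|²)^{1/2}` and `d` linear, so smoothness,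
boundedness of all derivatives and decay come from the symbol-type bounds of
`Literature.Analysis.FunctionSpaces.JapaneseBracketDerivatives`; `div u = 0` because `d` has zero
diagonal and `x · d(x) = 0`; the energy is computed as in the paper ((1.15)–(1.194): `|d(x)|² =
2|x|² − 2(x₁x₂+x₂x₃+x₃x₁)`, the mixed terms integrate to zero by the reflections `xᵢ ↦ −xᵢ`, and in
polar coordinates `∫_{ℝ³} 8|x|²(1+|x|²)⁻⁴ dx = 8 · 4π · ∫₀^∞ r⁴(1+r²)⁻⁴ dr = 32π · π/32 = π²`); the force
`(0,0,(1+t²(x₁+x₂+x₃)²)⁻¹)` is smooth on all of `ℝ × ℝ³`. The token `ClaimedTheorem`, every Step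
statement and all earlier declarations are untouched (append-only). -/

open Literature.Analysis.FunctionSpaces

/-- The bracket form of the printed field: `u(x) = (1+|x|²)^{-4/2} • (2 d(x))`. [cite: Kovacevic2016, Theorem 1.1 p.3] -/
private theorem uField_eq_bracket :
    uField = fun w : E3 => (1 + ‖w‖ ^ 2) ^ ((-4 : ℝ) / 2) • ((2 : ℝ) • dL) w := by
  rw [uField_eq]
  funext w
  have hpos : 0 < 1 + ‖w‖ ^ 2 := by positivity
  have h1 : (1 + ‖w‖ ^ 2) ^ ((-4 : ℝ) / 2) = ((1 + ‖w‖ ^ 2) ^ 2)⁻¹ := by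
    rw [show ((-4 : ℝ) / 2) = -(2 : ℝ) by norm_num, Real.rpow_neg hpos.le, Real.rpow_two]
  rw [h1, FunLike.coe_smul, Pi.smul_apply, smul_smul]
  unfold gK
  congr 1
  rw [div_eq_mul_inv, mul_comm]

/-- `u ∈ C^∞`. [cite: Kovacevic2016, p.2 and (1.3)–(1.14) p.3] -/
private theorem contDiff_uField : ContDiff ℝ ∞ uField := by
  rw [uField_eq_bracket]
  exact (contDiff_one_add_norm_sq_rpow (-4)).smul ((2 : ℝ) • dL).contDiff

/-- Every derivative of `u` is bounded on `ℝ³` (symbol of order `-4 + 1 < 0`,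
`Literature.Analysis.FunctionSpaces.exists_bound_iteratedFDeriv_one_add_norm_sq_rpow_smul`).
[cite: Kovacevic2016, p.2 («every derivative is bounded»)] -/
private theorem exists_bound_iteratedFDeriv_uField (n : ℕ) :
    ∃ C : ℝ, ∀ x : E3, ‖iteratedFDeriv ℝ n uField x‖ ≤ C := by
  rw [uField_eq_bracket]
  exact exists_bound_iteratedFDeriv_one_add_norm_sq_rpow_smul (by norm_num) ((2 : ℝ) • dL) n

/-- `u(0) = 0`. [cite: Kovacevic2016, p.2] -/
private theorem uField_zero : uField 0 = 0 := by
  have : dVec 0 = 0 := by ext i; fin_cases i <;> simp [dVec]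
  simp [uField, this]

/-- `‖u(x)‖ ≤ ‖d‖ / (1+‖x‖²)` (crude, from `2‖x‖ ≤ 1 + ‖x‖²`). [folklore] -/
private theorem norm_uField_le (x : E3) : ‖uField x‖ ≤ ‖dL‖ * (1 + ‖x‖ ^ 2)⁻¹ := by
  have hpos : 0 < 1 + ‖x‖ ^ 2 := by positivity
  have h1 : uField x = (2 / (1 + ‖x‖ ^ 2) ^ 2) • dL x := rfl
  have h2 : 2 * ‖x‖ ≤ 1 + ‖x‖ ^ 2 := by nlinarith [sq_nonneg (‖x‖ - 1)]
  rw [h1, norm_smul, Real.norm_of_nonneg (by positivity)]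
  calc 2 / (1 + ‖x‖ ^ 2) ^ 2 * ‖dL x‖ ≤ 2 / (1 + ‖x‖ ^ 2) ^ 2 * (‖dL‖ * ‖x‖) := by
        gcongr; exact dL.le_opNorm x
    _ = ‖dL‖ * (1 + ‖x‖ ^ 2)⁻¹ * (2 * ‖x‖ / (1 + ‖x‖ ^ 2)) := by
        field_simp
    _ ≤ ‖dL‖ * (1 + ‖x‖ ^ 2)⁻¹ * 1 := by
        gcongr; rwa [div_le_one hpos]
    _ = ‖dL‖ * (1 + ‖x‖ ^ 2)⁻¹ := mul_one _

/-- `u → 0` at infinity. [cite: Kovacevic2016, p.2] -/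
private theorem tendsto_uField_cocompact : Tendsto uField (cocompact E3) (𝓝 0) := by
  rw [tendsto_zero_iff_norm_tendsto_zero]
  have h1 : Tendsto (fun x : E3 => 1 + ‖x‖ ^ 2) (cocompact E3) atTop :=
    tendsto_atTop_add_const_left _ _
      ((tendsto_pow_atTop two_ne_zero).comp tendsto_norm_cocompact_atTop)
  have h2 : Tendsto (fun x : E3 => ‖dL‖ * (1 + ‖x‖ ^ 2)⁻¹) (cocompact E3) (𝓝 0) := by
    simpa using h1.inv_tendsto_atTop.const_mul ‖dL‖
  exact squeeze_zero (fun x => norm_nonneg _) norm_uField_le h2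

/-- `div u = 0`: `D u(x) v = g(|x|²) d(v) + c(x)⟨x,v⟩ d(x)`, the diagonal of `d` vanishes and
`Σᵢ xᵢ dᵢ(x) = 0`. [cite: Kovacevic2016, (1.14) p.3] -/
private theorem isDivFree_uField : NSWave0.IsDivFree uField := by
  intro x
  have hφd : DifferentiableAt ℝ (fun w : E3 => (1 + ‖w‖ ^ 2) ^ ((-4 : ℝ) / 2)) x :=
    (contDiff_one_add_norm_sq_rpow (-4) (n := 1)).differentiable one_ne_zero x
  have hfd : fderiv ℝ uField x = (1 + ‖x‖ ^ 2) ^ ((-4 : ℝ) / 2) • ((2 : ℝ) • dL) +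
      (fderiv ℝ (fun w : E3 => (1 + ‖w‖ ^ 2) ^ ((-4 : ℝ) / 2)) x).smulRight (((2 : ℝ) • dL) x) := by
    rw [uField_eq_bracket, fderiv_fun_smul hφd ((2 : ℝ) • dL).differentiableAt,
      ContinuousLinearMap.fderiv]
  have hφ' : fderiv ℝ (fun w : E3 => (1 + ‖w‖ ^ 2) ^ ((-4 : ℝ) / 2)) x =
      ((-4 : ℝ) * (1 + ‖x‖ ^ 2) ^ (((-4 : ℝ) - 2) / 2)) • innerSL ℝ x :=
    congrFun (fderiv_one_add_norm_sq_rpow (-4)) x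
  unfold NSWave0.divergence
  rw [LinearMap.trace_eq_sum_inner _ (EuclideanSpace.basisFun (Fin 3) ℝ), hfd, hφ']
  simp only [ContinuousLinearMap.coe_coe, _root_.add_apply,
    FunLike.coe_smul, Pi.smul_apply, ContinuousLinearMap.smulRight_apply,
    innerSL_apply_apply, dL_apply, EuclideanSpace.basisFun_apply, inner_add_right,
    real_inner_smul_right, Fin.sum_univ_three]
  simp [dVec, PiLp.inner_apply]
  ring

/-- The force is smooth on all of `ℝ × ℝ³` (`1 + t²(Σx)² ≥ 1`). [cite: Kovacevic2016, Theorem 1.1 p.3] -/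
private theorem contDiff_uncurry_force : ContDiff ℝ ∞ (Function.uncurry force) := by
  have hc : ∀ i : Fin 3, ContDiff ℝ ∞ (fun q : ℝ × E3 => q.2 i) := fun i =>
    contDiff_euclidean.1 contDiff_snd i
  have hlin : ContDiff ℝ ∞ (fun q : ℝ × E3 => q.2 0 + q.2 1 + q.2 2) :=
    ((hc 0).add (hc 1)).add (hc 2)
  have hden : ContDiff ℝ ∞ (fun q : ℝ × E3 => 1 + q.1 ^ 2 * (q.2 0 + q.2 1 + q.2 2) ^ 2) :=
    contDiff_const.add ((contDiff_fst.pow 2).mul (hlin.pow 2))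
  have hq : ContDiff ℝ ∞
      (fun q : ℝ × E3 => 1 / (1 + q.1 ^ 2 * (q.2 0 + q.2 1 + q.2 2) ^ 2)) :=
    contDiff_const.div hden fun q => by positivity
  refine contDiff_euclidean.2 fun i => ?_
  have hcoord : (fun q : ℝ × E3 => Function.uncurry force q i) = fun q =>
      if i = 2 then 1 / (1 + q.1 ^ 2 * (q.2 0 + q.2 1 + q.2 2) ^ 2) else 0 := by
    funext q
    rcases q with ⟨t, x⟩
    simp [force, PiLp.single_apply]
  rw [hcoord]
  split_ifs
  · exact hq
  · exact contDiff_const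

/-- `f` is smooth on the closed half-space. [cite: Kovacevic2016, Theorem 1.1 p.3] -/
private theorem isSmoothOnHalfSpace_force : IsSmoothOnHalfSpace force :=
  contDiff_uncurry_force.contDiffOn

/-! #### The energy `∫ |u|² dx = π²` ((1.15)–(1.194) pp.3–23 of the paper, by spherical coordinates) -/

/-- Antiderivative of the radial profile: `d/dy [arctan y /16 + (3y⁵−8y³−3y)/(48(1+y²)³)] =
y⁴/(1+y²)⁴`. [folklore] -/
private theorem hasDerivAt_radialPrim (y : ℝ) :
    HasDerivAt (fun y : ℝ => Real.arctan y / 16 + (3 * y ^ 5 - 8 * y ^ 3 - 3 * y) /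
      (48 * (1 + y ^ 2) ^ 3)) (y ^ 4 / (1 + y ^ 2) ^ 4) y := by
  have hq : (0 : ℝ) < 1 + y ^ 2 := by positivity
  have hP := (((hasDerivAt_pow 5 y).const_mul (3 : ℝ)).sub ((hasDerivAt_pow 3 y).const_mul (8 : ℝ))).sub
    ((hasDerivAt_id' y).const_mul (3 : ℝ))
  have hQ := ((((hasDerivAt_pow 2 y).const_add (1 : ℝ)).pow 3).const_mul (48 : ℝ))
  have h := ((Real.hasDerivAt_arctan y).div_const 16).add
    (hP.div hQ (ne_of_gt (by positivity : (0 : ℝ) < 48 * (1 + y ^ 2) ^ 3)))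
  have h' : HasDerivAt (fun y : ℝ => Real.arctan y / 16 + (3 * y ^ 5 - 8 * y ^ 3 - 3 * y) /
      (48 * (1 + y ^ 2) ^ 3)) _ y := h
  refine h'.congr_deriv ?_
  simp only [Pi.sub_apply, Pi.pow_apply]
  field_simp
  ring

/-- `∫₀^∞ y⁴/(1+y²)⁴ dy = π/32`. [folklore] -/
private theorem integral_radialProfile :
    ∫ y in Ioi (0 : ℝ), y ^ 4 / (1 + y ^ 2) ^ 4 = Real.pi / 32 := by
  -- the rational part of the antiderivative tends to `0`
  have hinv : Tendsto (fun y : ℝ => y⁻¹) atTop (𝓝 0) := tendsto_inv_atTop_zero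
  have hinv2 : Tendsto (fun y : ℝ => (y ^ 2)⁻¹) atTop (𝓝 0) :=
    tendsto_inv_atTop_zero.comp (tendsto_pow_atTop two_ne_zero)
  have hinv4 : Tendsto (fun y : ℝ => (y ^ 4)⁻¹) atTop (𝓝 0) :=
    tendsto_inv_atTop_zero.comp (tendsto_pow_atTop (by norm_num))
  have hrat : Tendsto (fun y : ℝ => (3 * y ^ 5 - 8 * y ^ 3 - 3 * y) / (48 * (1 + y ^ 2) ^ 3))
      atTop (𝓝 0) := by
    have h := (((tendsto_const_nhds (x := (3 : ℝ))).sub (hinv2.const_mul 8)).sub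
      (hinv4.const_mul 3)).mul hinv |>.div (((hinv2.add_const 1).pow 3).const_mul 48) (by norm_num)
    simp only [mul_zero, sub_zero, zero_add, one_pow, mul_one, zero_div] at h
    have h' : Tendsto (fun y : ℝ => ((3 - 8 * (y ^ 2)⁻¹ - 3 * (y ^ 4)⁻¹) * y⁻¹) /
        (48 * ((y ^ 2)⁻¹ + 1) ^ 3)) atTop (𝓝 0) := h
    refine h'.congr' ?_
    filter_upwards [eventually_gt_atTop (0 : ℝ)] with y hy
    field_simp
  have hlim : Tendsto (fun y : ℝ => Real.arctan y / 16 + (3 * y ^ 5 - 8 * y ^ 3 - 3 * y) /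
      (48 * (1 + y ^ 2) ^ 3)) atTop (𝓝 (Real.pi / 32)) := by
    have ha : Tendsto (fun y : ℝ => Real.arctan y / 16) atTop (𝓝 (Real.pi / 2 / 16)) :=
      (Real.tendsto_arctan_atTop.mono_right nhdsWithin_le_nhds).div_const 16
    convert ha.add hrat using 2
    ring
  rw [integral_Ioi_of_hasDerivAt_of_nonneg' (fun y _ => hasDerivAt_radialPrim y)
    (fun y _ => by positivity) hlim]
  simp

/-- `∫_{ℝ³} |x|²/(1+|x|²)⁴ dx = 3·(4π/3)·(π/32) = π²/8` (polar coordinates,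
`MeasureTheory.integral_fun_norm_addHaar`). [folklore] -/
private theorem integral_radial :
    ∫ x : E3, ‖x‖ ^ 2 / (1 + ‖x‖ ^ 2) ^ 4 = Real.pi ^ 2 / 8 := by
  have h := MeasureTheory.integral_fun_norm_addHaar (volume : Measure E3)
    (fun r : ℝ => r ^ 2 / (1 + r ^ 2) ^ 4)
  rw [h, finrank_euclideanSpace_fin, measureReal_def, EuclideanSpace.volume_ball_fin_three]
  have hI : ∫ y in Ioi (0 : ℝ), y ^ (3 - 1) • (y ^ 2 / (1 + y ^ 2) ^ 4) = Real.pi / 32 := by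
    have : ∀ y : ℝ, y ^ (3 - 1) • (y ^ 2 / (1 + y ^ 2) ^ 4) = y ^ 4 / (1 + y ^ 2) ^ 4 := by
      intro y; rw [smul_eq_mul, show (3 : ℕ) - 1 = 2 from rfl]; ring
    simp_rw [this]
    exact integral_radialProfile
  have hπ : (0 : ℝ) ≤ Real.pi * 4 / 3 := by positivity
  rw [hI]
  simp [ENNReal.toReal_ofReal hπ]
  ring

/-- The coordinate reflection `xᵢ ↦ −xᵢ` of `ℝ³` as a linear isometry. [folklore] -/
private def negCoord (i : Fin 3) : E3 ≃ₗᵢ[ℝ] E3 :=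
  LinearIsometryEquiv.piLpCongrRight 2 fun k =>
    if k = i then LinearIsometryEquiv.neg ℝ else LinearIsometryEquiv.refl ℝ ℝ

/-- Coordinates of the reflection `negCoord i`. [folklore] -/
private theorem negCoord_apply (i k : Fin 3) (x : E3) :
    negCoord i x k = if k = i then -x k else x k := by
  unfold negCoord
  rw [LinearIsometryEquiv.piLpCongrRight_apply, PiLp.toLp_apply]
  split_ifs <;> simp

/-- The cross terms `xᵢxⱼ/(1+|x|²)⁴`, `i ≠ j`, integrate to zero (odd under `xᵢ ↦ −xᵢ`).
[folklore] -/
private theorem integral_cross_eq_zero {i j : Fin 3} (hij : i ≠ j) :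
    ∫ x : E3, x i * x j / (1 + ‖x‖ ^ 2) ^ 4 = 0 := by
  set g : E3 → ℝ := fun x => x i * x j / (1 + ‖x‖ ^ 2) ^ 4 with hg
  have hR : (fun x => g (negCoord i x)) = fun x => -g x := by
    funext x
    simp only [hg, negCoord_apply, LinearIsometryEquiv.norm_map, if_neg hij.symm, ↓reduceIte]
    ring
  have h1 : ∫ x, g (negCoord i x) = ∫ x, g x :=
    (negCoord i).measurePreserving.integral_comp (negCoord i).toHomeomorph.measurableEmbedding g
  rw [hR, integral_neg] at h1
  linarith

/-- Integrability on `ℝ³` from a bound by `C (1+|x|²)^{-3}`. [folklore] -/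
private theorem integrable_of_le_bracket3 {f : E3 → ℝ} (hf : Continuous f) (C : ℝ)
    (hle : ∀ x, ‖f x‖ ≤ C * ((1 + ‖x‖ ^ 2) ^ 3)⁻¹) : Integrable f := by
  have h := (integrable_rpow_neg_one_add_norm_sq (E := E3) (μ := volume) (r := 6)
    (by rw [finrank_euclideanSpace_fin]; norm_num)).const_mul C
  refine h.mono' hf.aestronglyMeasurable (Eventually.of_forall fun x => ?_)
  have hpos : (0 : ℝ) < 1 + ‖x‖ ^ 2 := by positivity
  have : ((1 : ℝ) + ‖x‖ ^ 2) ^ (-(6 : ℝ) / 2) = ((1 + ‖x‖ ^ 2) ^ 3)⁻¹ := by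
    rw [show (-(6 : ℝ) / 2) = -((3 : ℕ) : ℝ) by norm_num, Real.rpow_neg hpos.le, Real.rpow_natCast]
  rw [this]
  exact hle x

/-- `|x|²/(1+|x|²)⁴` is integrable on `ℝ³` (decay order 6 > 3). [folklore] -/
private theorem integrable_radial : Integrable (fun x : E3 => ‖x‖ ^ 2 / (1 + ‖x‖ ^ 2) ^ 4) := by
  refine integrable_of_le_bracket3 ((continuous_norm.pow 2).div
    ((continuous_const.add (continuous_norm.pow 2)).pow 4) fun x => by positivity) 1 fun x => ?_
  have hpos : (0 : ℝ) < 1 + ‖x‖ ^ 2 := by positivity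
  rw [Real.norm_of_nonneg (by positivity), one_mul, div_le_iff₀ (by positivity)]
  rw [show ((1 + ‖x‖ ^ 2) ^ 3)⁻¹ * (1 + ‖x‖ ^ 2) ^ 4 = 1 + ‖x‖ ^ 2 by field_simp]
  linarith

/-- `xᵢxⱼ/(1+|x|²)⁴` is integrable on `ℝ³` (decay order 6 > 3). [folklore] -/
private theorem integrable_cross (i j : Fin 3) :
    Integrable (fun x : E3 => x i * x j / (1 + ‖x‖ ^ 2) ^ 4) := by
  have hc : ∀ k : Fin 3, Continuous fun x : E3 => x k := fun k => by fun_prop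
  refine integrable_of_le_bracket3 (((hc i).mul (hc j)).div
    ((continuous_const.add (continuous_norm.pow 2)).pow 4) fun x => by positivity) 1 fun x => ?_
  have hpos : (0 : ℝ) < 1 + ‖x‖ ^ 2 := by positivity
  have hi := PiLp.norm_apply_le x i
  have hj := PiLp.norm_apply_le x j
  rw [norm_div, norm_mul, norm_pow, Real.norm_of_nonneg hpos.le, one_mul,
    div_le_iff₀ (by positivity)]
  rw [show ((1 + ‖x‖ ^ 2) ^ 3)⁻¹ * (1 + ‖x‖ ^ 2) ^ 4 = 1 + ‖x‖ ^ 2 by field_simp]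
  nlinarith [mul_le_mul hi hj (norm_nonneg _) (norm_nonneg _), norm_nonneg (x i), norm_nonneg (x j)]

/-- `|u(x)|² = 8|x|²/(1+|x|²)⁴ − 8 Σ_{i<j} xᵢxⱼ/(1+|x|²)⁴` (since `|d(x)|² = 2|x|² − 2(x₀x₁+x₁x₂+x₂x₀)`).
[cite: Kovacevic2016, (1.15)–(1.20) pp.3–4] -/
private theorem norm_sq_uField (x : E3) :
    ‖uField x‖ ^ 2 = 8 * (‖x‖ ^ 2 / (1 + ‖x‖ ^ 2) ^ 4) - 8 * (x 0 * x 1 / (1 + ‖x‖ ^ 2) ^ 4)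
      - 8 * (x 1 * x 2 / (1 + ‖x‖ ^ 2) ^ 4) - 8 * (x 2 * x 0 / (1 + ‖x‖ ^ 2) ^ 4) := by
  have hpos : (0 : ℝ) < 1 + ‖x‖ ^ 2 := by positivity
  have hd : ‖dVec x‖ ^ 2 = 2 * ‖x‖ ^ 2 - 2 * (x 0 * x 1 + x 1 * x 2 + x 2 * x 0) := by
    rw [EuclideanSpace.real_norm_sq_eq, EuclideanSpace.real_norm_sq_eq]
    simp [dVec, Fin.sum_univ_three]
    ring
  have h1 : uField x = (2 / (1 + ‖x‖ ^ 2) ^ 2) • dVec x := rfl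
  rw [h1, norm_smul, mul_pow, Real.norm_of_nonneg (by positivity), hd]
  field_simp
  ring

/-- `∫_{ℝ³} |u|² dx = π²`. [cite: Kovacevic2016, (1.194) p.23] -/
private theorem integral_norm_sq_uField : ∫ x : E3, ‖uField x‖ ^ 2 = Real.pi ^ 2 := by
  have h0 := integrable_radial.const_mul 8
  have h1 := (integrable_cross 0 1).const_mul 8
  have h2 := (integrable_cross 1 2).const_mul 8
  have h3 := (integrable_cross 2 0).const_mul 8
  have h01 : Integrable (fun x : E3 => 8 * (‖x‖ ^ 2 / (1 + ‖x‖ ^ 2) ^ 4)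
      - 8 * (x 0 * x 1 / (1 + ‖x‖ ^ 2) ^ 4)) := h0.sub h1
  have h012 : Integrable (fun x : E3 => 8 * (‖x‖ ^ 2 / (1 + ‖x‖ ^ 2) ^ 4)
      - 8 * (x 0 * x 1 / (1 + ‖x‖ ^ 2) ^ 4) - 8 * (x 1 * x 2 / (1 + ‖x‖ ^ 2) ^ 4)) := h01.sub h2
  simp_rw [norm_sq_uField]
  rw [integral_sub h012 h3, integral_sub h01 h2, integral_sub h0 h1,
    integral_const_mul, integral_const_mul, integral_const_mul, integral_const_mul,
    integral_radial, integral_cross_eq_zero (by decide), integral_cross_eq_zero (by decide),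
    integral_cross_eq_zero (by decide)]
  ring

/-- `|u|²` is integrable on `ℝ³`. [cite: Kovacevic2016, (1.194) p.23] -/
private theorem integrable_norm_sq_uField : Integrable (fun x : E3 => ‖uField x‖ ^ 2) := by
  have h0 := integrable_radial.const_mul 8
  have h1 := (integrable_cross 0 1).const_mul 8
  have h2 := (integrable_cross 1 2).const_mul 8
  have h3 := (integrable_cross 2 0).const_mul 8
  have h : Integrable (fun x : E3 => 8 * (‖x‖ ^ 2 / (1 + ‖x‖ ^ 2) ^ 4)
      - 8 * (x 0 * x 1 / (1 + ‖x‖ ^ 2) ^ 4) - 8 * (x 1 * x 2 / (1 + ‖x‖ ^ 2) ^ 4)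
      - 8 * (x 2 * x 0 / (1 + ‖x‖ ^ 2) ^ 4)) := ((h0.sub h1).sub h2).sub h3
  exact h.congr (Eventually.of_forall fun x => (norm_sq_uField x).symm)

/-- The energy clause as typed: `∫⁻ ‖u‖ₑ² = ofReal π²`. [cite: Kovacevic2016, (1.194) p.23] -/
private theorem lintegral_enorm_sq_uField :
    (∫⁻ x, ‖uField x‖ₑ ^ 2) = ENNReal.ofReal (Real.pi ^ 2) := by
  have h : (fun x : E3 => ‖uField x‖ₑ ^ 2) = fun x => ENNReal.ofReal (‖uField x‖ ^ 2) := by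
    funext x
    rw [← ofReal_norm, ENNReal.ofReal_pow (norm_nonneg _)]
  rw [h, ← ofReal_integral_eq_lintegral_ofReal integrable_norm_sq_uField
    (Eventually.of_forall fun x => by positivity), integral_norm_sq_uField]

/-- **Step 1 holds in the kernel**: the printed fields have every property listed on p.2
(`u ∈ C^∞` divergence-free with `∫|u|² = π²`, `u(0) = 0`, `u → 0` at infinity, all derivatives
bounded; `f` smooth on the closed half-space). [cite: Kovacevic2016, p.2 bullets; (1.3)–(1.194) pp.3–23] -/
theorem fieldProperties_holds : FieldProperties :=
  ⟨contDiff_uField, isDivFree_uField, lintegral_enorm_sq_uField, uField_zero,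
    tendsto_uField_cocompact, exists_bound_iteratedFDeriv_uField, isSmoothOnHalfSpace_force⟩

end Literature.Claims.NS.Kovacevic2016

end

-- WHAT THIS IS NOT: not a claim about NS regularity or blow-up; not a claim about any author beyond the
-- typed locator.
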